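import Summits.BirchSwinnertonDyer.BirchSwinnertonDyer.Theorems.ClassRecordThreeEulerHalvesAtThreeCartanSupplyCubicDescentTrace
import Summits.BirchSwinnertonDyer.BirchSwinnertonDyer.Theorems.ClassRecordThreeEulerHalvesAtThreeCartanSupplyTorusLines
import HarnessLib

/-!
# The cubic lattice, I: transport of `L` to `ℤ^d`, its character, the invariant form, rank by trace

Helper file `--supports stmt-BirchSwinnertonDyer-23422` (seat `bsd-stepL-tam3-p1` g23, LINE OWNER of crux 23422, line `cartan` v11), serving the registered
stub (SUPPLY) `stub_cartanTorusLatticeSupply` (memo `HOME/tam3-p1/g23/SUPPLY-ROAD-GG1.md` §2), continuing `…CubicDescentTrace`. The descended lattice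
`L ⊂ ℤ[X]` (`…CubicDescent.latL`, character `χ_W` by `trace_actL`) is transported along a `ℤ`-basis (`Submodule.basisOfPid`) to `ℤ^d`
(`dL`, `bL`, `rho`, `trace_rho : tr ρ(g) = cubicNewvectorChar q g`), with the equivariant embedding `embI : ℤ^d ↪ ℤ[X]` and the restricted
standard form `formB(v, w) = Σ_x (Iv)(x)(Iw)(x)` — symmetric, positive definite, `G`-invariant (`formB_symm ∕ _pos ∕ _inv`). Generic RANK BY TRACE
(`exists_generator_of_trace_rep`, the pattern of bsd-idea-10 g12's `…TorusLines.exists_generator_of_trace` for an arbitrary free lattice):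
if `Σ_{t ∈ T₀} tr ρ(t) = |T₀|` then the `T₀`-fixed sublattice is a line with a generator. Part II: mod-3 condition, torus lines, SUPPLY at `q ≡ 1 (3)`.
HONEST FRAMING: linear algebra over `ℤ`; nothing about SUPPLY, NUM, crux 23422 ∕ 19109 is proved here; BSD is proved for no curve. [folklore]
-/

namespace Summit.BirchSwinnertonDyer.BirchSwinnertonDyer.Theorems.CartanSupply.CubicLattice

open Summit.BirchSwinnertonDyer.BirchSwinnertonDyer.Theorems.CartanDegree
open Summit.BirchSwinnertonDyer.BirchSwinnertonDyer.Theorems.CartanTorusCubeCut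
open Summit.BirchSwinnertonDyer.BirchSwinnertonDyer.Theorems.CartanSupply.CubicClasses
open Summit.BirchSwinnertonDyer.BirchSwinnertonDyer.Theorems.CartanSupply.CubicHecke
open Summit.BirchSwinnertonDyer.BirchSwinnertonDyer.Theorems.CartanSupply.CubicFibres
open Summit.BirchSwinnertonDyer.BirchSwinnertonDyer.Theorems.CartanSupply.CubicV1
open Summit.BirchSwinnertonDyer.BirchSwinnertonDyer.Theorems.CartanSupply.CubicDescent

set_option linter.dupNamespace false
set_option autoImplicit false

open scoped Classical

/-! ## §1 Generic rank by trace on a free `ℤ`-lattice -/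

section generic

variable {N : Type*} [AddCommGroup N] [Module.Free ℤ N] [Module.Finite ℤ N] {G : Type*} [Group G]

/-- PROVED — **RANK BY TRACE**: for a representation `ρ` of `G` on a free finitely generated `ℤ`-module and a finite subgroup `T₀` with
`Σ_{t ∈ T₀} tr ρ(t) = |T₀|`, the `T₀`-fixed sublattice is a line: there is `w ≠ 0` fixed by `T₀` of which every `T₀`-fixed vector is a
multiple. [folklore] -/
theorem exists_generator_of_trace_rep (ρ : G →* Module.End ℤ N) (T₀ : Subgroup G) [Fintype T₀]
    (hsum : ∑ t : T₀, LinearMap.trace ℤ N (ρ (t : G)) = Nat.card T₀) :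
    ∃ w : N, (∀ t ∈ T₀, ρ t w = w) ∧ w ≠ 0 ∧ ∀ v : N, (∀ t ∈ T₀, ρ t v = v) → ∃ m : ℤ, v = m • w := by
  -- the fixed sublattice `F`
  let F : Submodule ℤ N :=
    { carrier := {v | ∀ t ∈ T₀, ρ t v = v}
      add_mem' := fun {a b} ha hb t ht => by rw [map_add, ha t ht, hb t ht]
      zero_mem' := fun t _ => map_zero _
      smul_mem' := fun c {a} ha t ht => by rw [map_smul, ha t ht] }
  have hFmem : ∀ v : N, v ∈ F ↔ ∀ t ∈ T₀, ρ t v = v := fun v => Iff.rfl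
  obtain ⟨dF, bF⟩ := Submodule.basisOfPid (Module.Free.chooseBasis ℤ N) F
  haveI := Module.Free.of_basis bF
  haveI := Module.Finite.of_basis bF
  have hmul : ∀ (t s : G) (v : N), ρ t (ρ s v) = ρ (t * s) v := fun t s v => by rw [map_mul, Module.End.mul_apply]
  have hQmem : ∀ x : N, (∑ t : T₀, ρ (t : G) x) ∈ F := by
    intro x t ht
    rw [map_sum]
    simp only [hmul]
    exact Fintype.sum_equiv (Equiv.mulLeft (⟨t, ht⟩ : T₀)) _ _ (fun s => rfl)
  let Q : N →ₗ[ℤ] F :=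
    { toFun := fun x => ⟨∑ t : T₀, ρ (t : G) x, hQmem x⟩
      map_add' := by intro x y; apply Subtype.ext; simp only [Submodule.coe_add, map_add, Finset.sum_add_distrib]
      map_smul' := by intro c x; apply Subtype.ext; simp only [Submodule.coe_smul, map_smul, Finset.smul_sum, RingHom.id_apply] }
  let ι : F →ₗ[ℤ] N := F.subtype
  have h1 : ι ∘ₗ Q = ∑ t : T₀, ρ (t : G) := by
    apply LinearMap.ext; intro x
    rw [LinearMap.sum_apply]; rfl
  have h2 : LinearMap.trace ℤ N (ι ∘ₗ Q) = Nat.card T₀ := by rw [h1, map_sum, hsum]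
  have h3 : Q ∘ₗ ι = (Nat.card T₀ : ℤ) • LinearMap.id := by
    apply LinearMap.ext; intro y; apply Subtype.ext
    have hy : ∀ t : T₀, ρ (t : G) (y : N) = y := fun t => y.2 t t.2
    show (∑ t : T₀, ρ (t : G) (y : N)) = (((Nat.card T₀ : ℤ) • y : F) : N)
    simp only [hy, Finset.sum_const, Finset.card_univ, Submodule.coe_smul, Nat.card_eq_fintype_card]
    rw [← natCast_zsmul]
  have h4 : (Nat.card T₀ : ℤ) * 1 = (Nat.card T₀ : ℤ) * Module.finrank ℤ F := by
    have h := LinearMap.trace_comp_comm' Q ι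
    rw [h2, h3, map_smul, LinearMap.trace_id, smul_eq_mul] at h
    rw [mul_one]; exact h
  have hT : (Nat.card T₀ : ℤ) ≠ 0 := by exact_mod_cast Nat.card_pos.ne'
  have hrank : Module.finrank ℤ F = 1 := by exact_mod_cast (mul_left_cancel₀ hT h4).symm
  have hdF : dF = 1 := by
    have h := Module.finrank_eq_card_basis bF
    rw [hrank, Fintype.card_fin] at h
    exact h.symm
  subst hdF
  refine ⟨(bF 0 : F), (bF 0).2, fun h0 => bF.ne_zero 0 (Subtype.ext h0), ?_⟩
  intro v hv
  refine ⟨bF.repr ⟨v, (hFmem v).mpr hv⟩ 0, ?_⟩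
  have h := bF.sum_repr ⟨v, (hFmem v).mpr hv⟩
  rw [Fin.sum_univ_one] at h
  have h' := congrArg Subtype.val h
  rw [Submodule.coe_smul] at h'
  exact h'.symm

end generic

variable {q : ℕ} [Fact q.Prime]

/-! ## §2 Transport of `L` to `ℤ^d` -/

/-- A `ℤ`-basis of `L` (with its rank). -/
noncomputable def basisL (h1 : q % 3 = 1) : Σ n : ℕ, Module.Basis (Fin n) ℤ (latL h1) :=
  Submodule.basisOfPid (Pi.basisFun ℤ (X q)) (latL h1)

/-- The rank `d` of `L`. -/
noncomputable def dL (h1 : q % 3 = 1) : ℕ := (basisL h1).1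

/-- The basis of `L`. -/
noncomputable def bL (h1 : q % 3 = 1) : Module.Basis (Fin (dL h1)) ℤ (latL h1) := (basisL h1).2

/-- The action on `L` as a representation. -/
noncomputable def actLRep (h1 : q % 3 = 1) : Representation ℤ (G q) (latL h1) where
  toFun := actL h1
  map_one' := by
    apply LinearMap.ext; intro x; apply Subtype.ext
    show act ℤ (1 : G q) (x : X q → ℤ) = x
    rw [act_one]; rfl
  map_mul' := by
    intro g h; apply LinearMap.ext; intro x; apply Subtype.ext
    show act ℤ (g * h) (x : X q → ℤ) = act ℤ g (act ℤ h (x : X q → ℤ))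
    rw [act_mul]; rfl

/-- PROVED: unfolding. [folklore] -/
theorem actLRep_apply (h1 : q % 3 = 1) (g : G q) : actLRep h1 g = actL h1 g := rfl

/-- The transported representation `ρ` on `ℤ^d`. -/
noncomputable def rho (h1 : q % 3 = 1) : Representation ℤ (G q) (Fin (dL h1) → ℤ) where
  toFun g := (bL h1).equivFun.conj (actLRep h1 g)
  map_one' := by rw [map_one, Module.End.one_eq_id, LinearEquiv.conj_id]; rfl
  map_mul' := by intro g h; rw [map_mul, Module.End.mul_eq_comp, LinearEquiv.conj_comp]; rfl

/-- PROVED: unfolding. [folklore] -/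
theorem rho_apply (h1 : q % 3 = 1) (g : G q) (v : Fin (dL h1) → ℤ) :
    rho h1 g v = (bL h1).equivFun (actL h1 g ((bL h1).equivFun.symm v)) := rfl

/-- PROVED — **`tr ρ(g) = χ_W(g)`** (`cubicNewvectorChar q` BY NAME). [folklore] -/
theorem trace_rho (h1 : q % 3 = 1) (g : G q) : LinearMap.trace ℤ (Fin (dL h1) → ℤ) (rho h1 g) = cubicNewvectorChar q g := by
  rw [← trace_actL h1 g]
  exact LinearMap.trace_conj' _ _

/-- The equivariant embedding `ℤ^d ↪ ℤ[X]` (image `L`). -/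
noncomputable def embI (h1 : q % 3 = 1) : (Fin (dL h1) → ℤ) →ₗ[ℤ] (X q → ℤ) :=
  (latL h1).subtype ∘ₗ ((bL h1).equivFun.symm : (Fin (dL h1) → ℤ) →ₗ[ℤ] latL h1)

/-- PROVED: unfolding. [folklore] -/
theorem embI_apply (h1 : q % 3 = 1) (v : Fin (dL h1) → ℤ) : embI h1 v = (((bL h1).equivFun.symm v : latL h1) : X q → ℤ) := rfl

/-- PROVED: `embI` is injective. [folklore] -/
theorem embI_injective (h1 : q % 3 = 1) : Function.Injective (embI h1) :=
  Subtype.val_injective.comp (bL h1).equivFun.symm.injective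

/-- PROVED: the image of `embI` is `L`. [folklore] -/
theorem embI_mem (h1 : q % 3 = 1) (v : Fin (dL h1) → ℤ) : embI h1 v ∈ latL h1 := ((bL h1).equivFun.symm v).2

/-- PROVED: every element of `L` is in the image. [folklore] -/
theorem exists_embI_eq (h1 : q % 3 = 1) {φ : X q → ℤ} (hφ : φ ∈ latL h1) : ∃ v, embI h1 v = φ :=
  ⟨(bL h1).equivFun ⟨φ, hφ⟩, by rw [embI_apply, LinearEquiv.symm_apply_apply]⟩

/-- PROVED: equivariance of the embedding. [folklore] -/
theorem embI_rho (h1 : q % 3 = 1) (g : G q) (v : Fin (dL h1) → ℤ) : embI h1 (rho h1 g v) = act ℤ g (embI h1 v) := by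
  rw [rho_apply, embI_apply, LinearEquiv.symm_apply_apply]; rfl

/-- PROVED: `(act g φ)(g ⋆ x) = φ(x)`. [folklore] -/
theorem act_apply_perm (g : G q) (φ : X q → ℤ) (x : X q) : act ℤ g φ (σX g x) = φ x := by
  rw [act_apply, ← Equiv.Perm.mul_apply, ← map_mul, inv_mul_cancel, map_one, Equiv.Perm.one_apply]

/-! ## §3 The invariant form -/

/-- The restricted standard form `B(v, w) = Σ_x (Iv)(x)(Iw)(x)`. -/
noncomputable def formB (h1 : q % 3 = 1) : (Fin (dL h1) → ℤ) →ₗ[ℤ] (Fin (dL h1) → ℤ) →ₗ[ℤ] ℤ :=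
  LinearMap.mk₂ ℤ (fun v w => ∑ x, embI h1 v x * embI h1 w x)
    (by intro v₁ v₂ w; simp only [map_add, Pi.add_apply, add_mul, Finset.sum_add_distrib])
    (by intro c v w; simp only [map_smul, Pi.smul_apply, smul_eq_mul, mul_assoc, Finset.mul_sum])
    (by intro v w₁ w₂; simp only [map_add, Pi.add_apply, mul_add, Finset.sum_add_distrib])
    (by intro c v w; simp only [map_smul, Pi.smul_apply, smul_eq_mul, Finset.mul_sum, mul_left_comm])

/-- PROVED: unfolding. [folklore] -/
theorem formB_apply (h1 : q % 3 = 1) (v w : Fin (dL h1) → ℤ) : formB h1 v w = ∑ x, embI h1 v x * embI h1 w x := rfl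

/-- PROVED: symmetry. [folklore] -/
theorem formB_symm (h1 : q % 3 = 1) (v w : Fin (dL h1) → ℤ) : formB h1 v w = formB h1 w v := by
  rw [formB_apply, formB_apply]; exact Finset.sum_congr rfl (fun x _ => mul_comm _ _)

/-- PROVED: positivity. [folklore] -/
theorem formB_pos (h1 : q % 3 = 1) (v : Fin (dL h1) → ℤ) (hv : v ≠ 0) : 0 < formB h1 v v := by
  rw [formB_apply]
  have hIv : embI h1 v ≠ 0 := fun h => hv (embI_injective h1 (by rw [h, map_zero]))
  obtain ⟨x, hx⟩ : ∃ x, embI h1 v x ≠ 0 := by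
    by_contra h
    simp only [not_exists, not_not] at h
    exact hIv (funext h)
  exact Finset.sum_pos' (fun y _ => mul_self_nonneg _) ⟨x, Finset.mem_univ _, mul_self_pos.mpr hx⟩

/-- PROVED: `G`-invariance. [folklore] -/
theorem formB_inv (h1 : q % 3 = 1) (g : G q) (v w : Fin (dL h1) → ℤ) : formB h1 (rho h1 g v) (rho h1 g w) = formB h1 v w := by
  rw [formB_apply, formB_apply, embI_rho, embI_rho, ← Equiv.sum_comp (σX g) (fun x => act ℤ g (embI h1 v) x * act ℤ g (embI h1 w) x)]
  simp only [act_apply_perm]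

end Summit.BirchSwinnertonDyer.BirchSwinnertonDyer.Theorems.CartanSupply.CubicLattice
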